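import Summits.ResolutionOfSingularities.ResolutionOfSingularities.Theorems.MarkedTransferCampaignW46TameSurfaceOrderReductionGlobal
import Literature.AlgebraicGeometry.Resolution.KollarSurfaceOrderReductionTameSurface
import HarnessLib

/-!
# [OURS · L1 W4.6, rung (iv) «large characteristic» ∩ rung (i) «surfaces»] In the regime `charGT n (fun _ b ↦ b) ∩ dimLE 2`
# the characteristic-zero order reduction of EVERY state of maximal order of the TYPED procedure is ONE smooth blow-up sequence
# on `Z` with empty final `Sing` — no finiteness hypothesis on `Sing` (cell res-hironaka, LADDER-RESOLUTION rung L, D-0089;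
# slot W4.6, seat res-L1-s46-pv-7; host route MarkedTransfer, `--supports stmt-ResolutionOfSingularities-16155 --as helper`)

HONEST FRAMING. Nothing here is a statement of H. Hironaka's manuscript (2017-03-23, [Hironaka2017]) and nothing here
asserts that any statement of it holds. OURS corollary, over the shared typed-procedure module
`MarkedTransferCampaignW46TypedProcedure` (res-L1-type-o1: `CampaignW46.Regime.charGT`, `Regime.dimLE`, `Regime.inter`;
the manuscript enters only through the typed CANDIDATE carriers `AmbientDatum`, `IdealExponent`, `IdealExponent.sing`,
used as definitions), of this seat's Literature file `KollarSurfaceOrderReductionTameSurface.lean`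
(`Kollar2007.exists_isResolutionOf_of_topologicalKrullDim_le_two`: Kollár's Thm. 3.69 — order reduction for marked
ideals — in dimension two for `p > max-ord`, kernel-proved: the curve part of the cosupport is a regular curve along
which `𝓘 = 𝓘_C^b`, blown up first (3.111 Step 1), then the glued local order reductions at the finitely many remaining
points (3.104 Step 2.2, 3.105)). No premise of the manuscript, no FACT-LIST premise. AI review is weaker than expert
review. No `sorry`, no new definition; axioms standard.

## What this file pins — the honest `C` for surfaces is the order `b`, globally and unconditionally on `Sing`

* **`exists_isResolutionOf_of_charGT_dimLE`** — for a state `(A, E)`, `E = (J, b)`, over a PERFECT field `K` of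
  characteristic `p`, in `Regime.inter (Regime.charGT n (fun _ b ↦ b)) (Regime.dimLE 2)` («`p > b`», «`dim Z ≤ 2`»),
  with `1 ≤ b` and `J` of maximal order `b`: there is `s : CentreSeq Z` RESOLVING `(Z, J, ∅, b)` (BGMW Def. 3.1.3: regular
  centres in the successive `Sing`, simple normal crossings with the exceptional boundary, EMPTY final `Sing`);
* `exists_isResolutionOf_of_le_dimLE'` — the same in every regime `charGT n f ∩ dimLE 2` with `(fun _ b ↦ b) ≤ f`;
* `sing_final_eq_empty_of_charGT_dimLE` — reading of the conclusion.

What is NOT here: `dim Z ≥ 3` (the second level is a surface with boundary and marking `b!`, gen 5); the identification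
of the produced `CentreSeq` (the tree's chosen blow-ups) with a typed `Run`.

## References (context; nothing is cited as a premise)

* J. Kollár, *Lectures on Resolution of Singularities* (2007), Thm. 3.69, 3.104, 3.105, 3.111 — through this seat's
  Literature files. [cite: Kollar2007, Thm. 3.69]
* E. Bierstone, D. Grigoriev, P. Milman, J. Włodarczyk (2011), Def. 3.1.3, Thm. 8.0.4.
  [cite: BierstoneGrigorievMilmanWlodarczyk2011, Thm. 8.0.4]
-/

noncomputable section

set_option linter.dupNamespace false -- mandated namespace of this single-conjunct summit

open CategoryTheory AlgebraicGeometry TopologicalSpace IsLocalRing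

namespace Summit.ResolutionOfSingularities.ResolutionOfSingularities.Theorems
namespace CampaignW46
namespace TameSurfaceOrderReduction

open Literature.AlgebraicGeometry.Resolution
open Literature.AlgebraicGeometry.Hironaka2017.S02Preliminaries

universe u

variable {n : ℕ} {p : ℕ} [Fact p.Prime] {K : Type u} [Field K] [CharP K p]

/-- [OURS · L1 W4.6 (iv) ∩ (i); NOT a statement of the manuscript] **In the regime `charGT n (fun _ b ↦ b) ∩ dimLE 2`,
the characteristic-zero order reduction of every state of maximal order is ONE smooth blow-up sequence on `Z`.** For
`(A, E)`, `E = (J, b)`, over a perfect field `K` of characteristic `p`, with `b < p`, `dim Z ≤ 2`, `1 ≤ b` and `ord_ξ J ≤ b`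
everywhere: there is `s : CentreSeq Z` RESOLVING `(Z, J, ∅, b)` (`CentreSeq.IsResolutionOf`). `Z` is Noetherian
(quasi-compact and smooth over `K`); instance of `Kollar2007.exists_isResolutionOf_of_topologicalKrullDim_le_two`.
[cite: Kollar2007, Thm. 3.69] -/
theorem exists_isResolutionOf_of_charGT_dimLE [PerfectField K] (A : AmbientDatum p K) (E : IdealExponent A.Z)
    (hE : Regime.inter (Regime.charGT (p := p) (K := K) n (fun _ b => b)) (Regime.dimLE 2) A E) (hb : 1 ≤ E.b)
    (hmax : ∀ ξ : A.Z, idealOrder E.J ξ ≤ E.b) :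
    ∃ s : CentreSeq A.Z, s.IsResolutionOf ⟨E.J, [], E.b⟩ := by
  letI : A.Z.Over (Spec (.of K)) := ⟨A.hom⟩
  haveI : Smooth (A.Z ↘ Spec (.of K)) := A.smooth
  haveI : QuasiCompact A.hom := A.quasiCompact
  haveI : IsLocallyNoetherian A.Z := isLocallyNoetherian_of_locallyOfFiniteType_over K A.Z
  haveI : CompactSpace A.Z := QuasiCompact.compactSpace_of_compactSpace A.hom
  haveI : IsNoetherian A.Z := {}
  have hbp : E.b < p := hE.1
  have hdim : topologicalKrullDim A.Z ≤ 2 := hE.2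
  exact Kollar2007.exists_isResolutionOf_of_topologicalKrullDim_le_two K A.Z p hdim E.J hb (Or.inr hbp) hmax

/-- [OURS · L1 W4.6 (iv) ∩ (i)] The same in every regime `charGT n f ∩ dimLE 2` whose threshold dominates the order,
`(fun _ b ↦ b) ≤ f` (e.g. `fun _ b ↦ b !`), by `Regime.charGT_of_le` (p471737). [cite: Kollar2007, Thm. 3.69] -/
theorem exists_isResolutionOf_of_le_dimLE' [PerfectField K] {f : ℕ → ℕ → ℕ} (hf : (fun _ b : ℕ => b) ≤ f)
    (A : AmbientDatum p K) (E : IdealExponent A.Z)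
    (hE : Regime.inter (Regime.charGT (p := p) (K := K) n f) (Regime.dimLE 2) A E) (hb : 1 ≤ E.b)
    (hmax : ∀ ξ : A.Z, idealOrder E.J ξ ≤ E.b) :
    ∃ s : CentreSeq A.Z, s.IsResolutionOf ⟨E.J, [], E.b⟩ :=
  exists_isResolutionOf_of_charGT_dimLE A E ⟨Regime.charGT_of_le (fun b => hf n b) A E hE.1, hE.2⟩ hb hmax

/-- [OURS · L1 W4.6 (iv) ∩ (i)] **Reading of the conclusion**: for the sequence produced above every centre is regular,
lies in the current order-`≥ b` locus and has simple normal crossings with the exceptional divisors created so far, and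
the order-`≥ b` locus (`IdealExponent.sing`) of the final controlled transform is EMPTY.
[cite: BierstoneGrigorievMilmanWlodarczyk2011, Def. 3.1.3] -/
theorem sing_final_eq_empty_of_charGT_dimLE [PerfectField K] (A : AmbientDatum p K) (E : IdealExponent A.Z)
    (hE : Regime.inter (Regime.charGT (p := p) (K := K) n (fun _ b => b)) (Regime.dimLE 2) A E) (hb : 1 ≤ E.b)
    (hmax : ∀ ξ : A.Z, idealOrder E.J ξ ≤ E.b) :
    ∃ s : CentreSeq A.Z, s.IsAdmissibleFor ⟨E.J, [], E.b⟩ ∧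
      (IdealExponent.sing ⟨(s.transformMarked ⟨E.J, [], E.b⟩).ideal, (s.transformMarked ⟨E.J, [], E.b⟩).mult⟩ :
        Set s.top) = ∅ := by
  obtain ⟨s, hs⟩ := exists_isResolutionOf_of_charGT_dimLE A E hE hb hmax
  exact ⟨s, sing_transform_eq_empty hs⟩

end TameSurfaceOrderReduction
end CampaignW46
end Summit.ResolutionOfSingularities.ResolutionOfSingularities.Theorems

end
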